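import Summits.NavierStokesRegularity.NavierStokesRegularity.Theorems.AdaptedFrequencyAdaptedFrequencyConvergesStubBlockSolverSource
import Summits.NavierStokesRegularity.NavierStokesRegularity.Theorems.AdaptedFrequencyAdaptedKernelExistsWeakCorrectorLions

/-!
# Crux `AdaptedFrequencyConverges` (stmt-NavierStokesRegularity-10493), line
  `cloud-frame-effective-tsai`: Lions' projection lemma for STUB `stub_blockSolver`
  (the very weak `L²` corrector of the caloric extension, globally smooth cut-off drift)

Helper file (lands `--supports stmt-NavierStokesRegularity-10493`).  For `ν > 0`, times
`ta < T₁ < Ta < T`, a GLOBALLY smooth drift `b` on `ℝ × ℝ³` with divergence-free slices, bounded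
and vanishing for `t ≥ T₁`, and the backward caloric extension `F(t, x) = e^{ν(T−t)Δ}f(x)` of
smooth compactly supported data `f`, there is a measurable `w ∈ L²(ℝ × ℝ³)`, vanishing off the
strip `(ta, Ta) × ℝ³`, such that `F + w` is locally integrable on the open slab `(ta, T) × ℝ³`
and a very weak solution of `∂ₜG + b·∇G + νΔG = 0` there:
`∫ (F + w)(∂ₜφ + b·∇φ − νΔφ) = 0` for all smooth `φ` compactly supported in the slab
(`corrector_core`).

This is the tree's `weakCorrector_core` (file `…AdaptedKernelExistsWeakCorrectorLions`, Trèves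
1975, §41, Lemma 41.2 with the exponential shift; `Literature.Analysis.PDE.lions_projection`)
VERBATIM with the backward heat kernel `Γ` replaced by `F`: the two inputs specific to the free
solution are the square integrability of the weighted source `(b·∇F)eᵗ` on the strip
(`caloric_memLp_source`) and the integration by parts `∫ F(∂ₜφ + b·∇φ − νΔφ) = −∫ (b·∇F)φ`
(`caloric_ibp`).
-/

noncomputable section

open MeasureTheory Set Filter Topology Metric Function
open scoped ContDiff Laplacian InnerProductSpace
open Literature.Analysis.FluidPDE Literature.Analysis.PDE Literature.Analysis.UnboundedOperators
open Summit.NavierStokesRegularity.NavierStokesRegularity.Theorems.AdaptedKernelExists.NashEntropyLastBlock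

namespace Summit.NavierStokesRegularity.NavierStokesRegularity.Theorems.AdaptedFrequencyConverges.CloudFrameEffectiveTsai

variable {ν T ta T₁ Ta B : ℝ} {f : EuclideanSpace ℝ (Fin 3) → ℝ} {F : ℝ → EuclideanSpace ℝ (Fin 3) → ℝ}
  {b : ℝ → EuclideanSpace ℝ (Fin 3) → EuclideanSpace ℝ (Fin 3)}

/-- **The very weak `L²` corrector of the caloric extension, for a globally smooth cut-off
drift** (Lions' projection lemma, Trèves 1975 §41): see the module docstring. -/
theorem corrector_core (hν : 0 < ν) (hf : ContDiff ℝ 2 f) (hfc : HasCompactSupport f)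
    (hF : F = fun t x => heatExtension f (ν * (T - t)) x) (hta : ta < T₁) (hT₁ : T₁ < Ta)
    (hTa : Ta < T) (hb : ContDiff ℝ ∞ (uncurry b)) (hdiv : ∀ t, VectorCalculus.IsDivFree (b t))
    (hB : ∀ t x, ‖b t x‖ ≤ B) (hb0 : ∀ t, T₁ ≤ t → ∀ x, b t x = 0) :
    ∃ w : ℝ × EuclideanSpace ℝ (Fin 3) → ℝ, Measurable w ∧ MemLp w 2 volume ∧
      (∀ p, p.1 ∉ Ioo ta Ta → w p = 0) ∧
      LocallyIntegrableOn (fun p => F p.1 p.2 + w p) (Ioo ta T ×ˢ univ) volume ∧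
      ∀ φ : ℝ × EuclideanSpace ℝ (Fin 3) → ℝ, ContDiff ℝ ∞ φ → HasCompactSupport φ →
        tsupport φ ⊆ Ioo ta T ×ˢ univ →
        ∫ p, (F p.1 p.2 + w p) *
          (deriv (fun s => φ (s, p.2)) p.1 + fderiv ℝ (fun y => φ (p.1, y)) p.2 (b p.1 p.2) -
            ν * (Δ (fun y => φ (p.1, y))) p.2) = 0 := by
  classical
  -- the strip
  set S : Set (ℝ × EuclideanSpace ℝ (Fin 3)) := Ioo ta Ta ×ˢ univ with hS
  have hSm : MeasurableSet S := measurableSet_Ioo.prod MeasurableSet.univ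
  have htaTa : ta < Ta := hta.trans hT₁
  set μ : Measure (ℝ × EuclideanSpace ℝ (Fin 3)) := volume.restrict S with hμ
  have hb1 : ContDiff ℝ 1 (uncurry b) := contDiff_infty.1 hb 1
  have hbc : Continuous (uncurry b) := hb.continuous
  have hFc : ContinuousOn (fun p : ℝ × EuclideanSpace ℝ (Fin 3) => F p.1 p.2) (Iio T ×ˢ univ) :=
    (caloric_isSmoothSpaceTimeOn hν hf.continuous hfc hF).continuousOn
  -- the operator `K = ∂ₜ + b·∇ − νΔ + 1` on functions
  obtain ⟨Kf, hKf⟩ : ∃ Kf : (ℝ × EuclideanSpace ℝ (Fin 3) → ℝ) → ℝ × EuclideanSpace ℝ (Fin 3) →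
      ℝ, Kf = fun ψ p =>
      deriv (fun s => ψ (s, p.2)) p.1 + fderiv ℝ (fun y => ψ (p.1, y)) p.2 (b p.1 p.2) -
        ν * (Δ (fun y => ψ (p.1, y))) p.2 + ψ p := ⟨_, rfl⟩
  have hKc : ∀ {ψ : ℝ × EuclideanSpace ℝ (Fin 3) → ℝ}, ContDiff ℝ ∞ ψ → Continuous (Kf ψ) := by
    intro ψ hψ
    rw [hKf]
    exact (((weakCorrector_continuous_deriv_slice (weakCorrector_contDiff_one_of_infty hψ)).add
      (weakCorrector_continuous_fderiv_slice (weakCorrector_contDiff_one_of_infty hψ) hbc)).sub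
      (continuous_const.mul (weakCorrector_continuous_laplacian_slice hψ))).add hψ.continuous
  have hKs : ∀ {ψ : ℝ × EuclideanSpace ℝ (Fin 3) → ℝ}, ContDiff ℝ ∞ ψ → HasCompactSupport ψ →
      HasCompactSupport (Kf ψ) := by
    intro ψ hψ hψc
    refine weakCorrector_hasCompactSupport_of_eq_zero hψc fun p hp => ?_
    simp only [hKf]
    rw [weakCorrector_deriv_slice_eq_zero (weakCorrector_contDiff_one_of_infty hψ) hp,
      weakCorrector_fderiv_slice_eq_zero (weakCorrector_contDiff_one_of_infty hψ) hp,
      weakCorrector_laplacian_slice_eq_zero (weakCorrector_contDiff_two_of_infty hψ) hp,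
      image_eq_zero_of_notMem_tsupport hp]
    ring
  -- the test space
  set Φ : Submodule ℝ (ℝ × EuclideanSpace ℝ (Fin 3) → ℝ) :=
    { carrier := {ψ | ContDiff ℝ ∞ ψ ∧ HasCompactSupport ψ ∧ ∀ p : ℝ × EuclideanSpace ℝ (Fin 3),
        p.1 ≤ ta → ψ p = 0}
      add_mem' := by
        rintro ψ χ ⟨hψ, hψc, hψ0⟩ ⟨hχ, hχc, hχ0⟩
        exact ⟨hψ.add hχ, hψc.add hχc, fun p hp => by
          simp only [Pi.add_apply, hψ0 p hp, hχ0 p hp, add_zero]⟩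
      zero_mem' := ⟨contDiff_const, by
        simpa using (HasCompactSupport.zero : HasCompactSupport (0 : ℝ × EuclideanSpace ℝ (Fin 3)
            → ℝ)),
        fun p _ => rfl⟩
      smul_mem' := by
        rintro c ψ ⟨hψ, hψc, hψ0⟩
        exact ⟨hψ.const_smul c, hψc.smul_left, fun p hp => by
          simp only [Pi.smul_apply, hψ0 p hp, smul_zero]⟩ } with hΦ
  have hΦs : ∀ ψ : Φ, ContDiff ℝ ∞ (ψ : ℝ × EuclideanSpace ℝ (Fin 3) → ℝ) := fun ψ => ψ.2.1
  have hΦc : ∀ ψ : Φ, HasCompactSupport (ψ : ℝ × EuclideanSpace ℝ (Fin 3) → ℝ) := fun ψ => ψ.2.2.1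
  have hΦ0 : ∀ ψ : Φ, ∀ p : ℝ × EuclideanSpace ℝ (Fin 3), p.1 ≤ ta → (ψ : ℝ × (EuclideanSpace ℝ
      (Fin 3)) → ℝ) p = 0 := fun ψ => ψ.2.2.2
  -- `L²(S)` memberships
  have hmemφ : ∀ ψ : Φ, MemLp (ψ : ℝ × EuclideanSpace ℝ (Fin 3) → ℝ) 2 μ := fun ψ =>
    weakCorrector_memLp_restrict (hΦs ψ).continuous (hΦc ψ) S
  have hmemK : ∀ ψ : Φ, MemLp (Kf ψ) 2 μ := fun ψ =>
    weakCorrector_memLp_restrict (hKc (hΦs ψ)) (hKs (hΦs ψ) (hΦc ψ)) S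
  -- the linear maps `j`, `K`
  set j : Φ →ₗ[ℝ] Lp ℝ 2 μ :=
    { toFun := fun ψ => (hmemφ ψ).toLp (ψ : ℝ × EuclideanSpace ℝ (Fin 3) → ℝ)
      map_add' := fun ψ χ => MemLp.toLp_add (hmemφ ψ) (hmemφ χ)
      map_smul' := fun c ψ => MemLp.toLp_const_smul c (hmemφ ψ) } with hj
  have hKadd : ∀ ψ χ : Φ, Kf ((ψ + χ : Φ) : ℝ × EuclideanSpace ℝ (Fin 3) → ℝ) = Kf ψ + Kf χ := by
    intro ψ χ
    funext p
    have h1 := weakCorrector_contDiff_one_of_infty (hΦs ψ)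
    have h2 := weakCorrector_contDiff_one_of_infty (hΦs χ)
    simp only [hKf, Submodule.coe_add]
    rw [weakCorrector_deriv_slice_add h1 h2, weakCorrector_fderiv_slice_add h1 h2,
      weakCorrector_laplacian_slice_add (weakCorrector_contDiff_two_of_infty (hΦs ψ))
        (weakCorrector_contDiff_two_of_infty (hΦs χ)), Pi.add_apply, Pi.add_apply]
    ring
  have hKsmul : ∀ (c : ℝ) (ψ : Φ), Kf ((c • ψ : Φ) : ℝ × EuclideanSpace ℝ (Fin 3) → ℝ) = c • Kf ψ
      := by
    intro c ψ
    funext p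
    have h1 := weakCorrector_contDiff_one_of_infty (hΦs ψ)
    simp only [hKf, Submodule.coe_smul]
    rw [weakCorrector_deriv_slice_smul, weakCorrector_fderiv_slice_smul h1,
      weakCorrector_laplacian_slice_smul (weakCorrector_contDiff_two_of_infty (hΦs ψ)),
      Pi.smul_apply, Pi.smul_apply, smul_eq_mul, smul_eq_mul]
    ring
  set K : Φ →ₗ[ℝ] Lp ℝ 2 μ :=
    { toFun := fun ψ => (hmemK ψ).toLp (Kf ψ)
      map_add' := fun ψ χ => by
        have h1 : (hmemK (ψ + χ)).toLp (Kf ((ψ + χ : Φ) : ℝ × EuclideanSpace ℝ (Fin 3) → ℝ)) =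
            ((hmemK ψ).add (hmemK χ)).toLp (Kf ψ + Kf χ) :=
          MemLp.toLp_congr _ _ (Eventually.of_forall fun p => by rw [hKadd])
        rw [h1]
        exact MemLp.toLp_add (hmemK ψ) (hmemK χ)
      map_smul' := fun c ψ => by
        have h1 : (hmemK (c • ψ)).toLp (Kf ((c • ψ : Φ) : ℝ × EuclideanSpace ℝ (Fin 3) → ℝ)) =
            ((hmemK ψ).const_smul c).toLp (c • Kf ψ) :=
          MemLp.toLp_congr _ _ (Eventually.of_forall fun p => by rw [hKsmul])
        rw [h1]
        exact MemLp.toLp_const_smul c (hmemK ψ) } with hK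
  -- the source functional `ℓ ψ = ∫_S (b·∇Γ) e^{t} ψ`
  obtain ⟨gF, hgF⟩ : ∃ gF : ℝ × EuclideanSpace ℝ (Fin 3) → ℝ, gF = fun p =>
      fderiv ℝ (F p.1) p.2 (b p.1 p.2) * Real.exp p.1 := ⟨_, rfl⟩
  have hgF2 : MemLp gF 2 μ := by
    rw [hgF]; exact caloric_memLp_source hν (hf.of_le one_le_two) hfc hF htaTa hTa hbc hB
  have hℓi : ∀ ψ : Φ, Integrable (fun p => gF p * (ψ : ℝ × EuclideanSpace ℝ (Fin 3) → ℝ) p) μ :=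
      fun ψ =>
    hgF2.integrable_mul (hmemφ ψ)
  set ℓ : Φ →ₗ[ℝ] ℝ :=
    { toFun := fun ψ => ∫ p, gF p * (ψ : ℝ × EuclideanSpace ℝ (Fin 3) → ℝ) p ∂μ
      map_add' := fun ψ χ => by
        rw [← integral_add (hℓi ψ) (hℓi χ)]
        exact integral_congr_ae (Eventually.of_forall fun p => by
          simp only [Submodule.coe_add, Pi.add_apply]; ring)
      map_smul' := fun c ψ => by
        rw [RingHom.id_apply, smul_eq_mul, ← MeasureTheory.integral_const_mul]
        exact integral_congr_ae (Eventually.of_forall fun p => by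
          simp only [Submodule.coe_smul, Pi.smul_apply, smul_eq_mul]; ring) } with hℓ
  -- the gauge
  set nΦ : Φ → ℝ := fun ψ => ‖j ψ‖ with hnΦ
  -- (i) coercivity
  have hcoer : ∀ ψ : Φ, 1 * nΦ ψ ^ 2 ≤ ⟪K ψ, j ψ⟫_ℝ := by
    intro ψ
    have hK' : ⟪K ψ, j ψ⟫_ℝ = ∫ p, Kf ψ p * (ψ : ℝ × EuclideanSpace ℝ (Fin 3) → ℝ) p ∂μ :=
      weakCorrector_inner_toLp_toLp (hmemK ψ) (hmemφ ψ)
    have hn : nΦ ψ ^ 2 = ∫ p, (ψ : ℝ × EuclideanSpace ℝ (Fin 3) → ℝ) p ^ 2 ∂μ := by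
      rw [hnΦ]
      dsimp only
      rw [← real_inner_self_eq_norm_sq]
      change ⟪(hmemφ ψ).toLp (ψ : ℝ × EuclideanSpace ℝ (Fin 3) → ℝ), (hmemφ ψ).toLp (ψ : ℝ ×
          EuclideanSpace ℝ (Fin 3) → ℝ)⟫_ℝ = _
      rw [weakCorrector_inner_toLp_toLp (hmemφ ψ) (hmemφ ψ)]
      exact integral_congr_ae (Eventually.of_forall fun p => (sq _).symm)
    rw [one_mul, hK', hn, hμ]
    simp only [hKf]
    exact weakCorrector_energy hν.le htaTa hb1 hdiv (hΦs ψ) (hΦc ψ)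
      (fun x => hΦ0 ψ (ta, x) le_rfl)
  -- (ii) the inclusion is bounded
  have hemb : ∀ ψ : Φ, ‖j ψ‖ ≤ 1 * nΦ ψ := fun ψ => by rw [one_mul]
  -- (iii) the functional is bounded
  have hℓb : ∀ ψ : Φ, |ℓ ψ| ≤ ‖hgF2.toLp gF‖ * nΦ ψ := by
    intro ψ
    change |∫ p, gF p * (ψ : ℝ × EuclideanSpace ℝ (Fin 3) → ℝ) p ∂μ| ≤ ‖hgF2.toLp gF‖ * ‖(hmemφ
        ψ).toLp (ψ : ℝ × EuclideanSpace ℝ (Fin 3) → ℝ)‖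
    rw [← weakCorrector_inner_toLp_toLp hgF2 (hmemφ ψ)]
    exact abs_real_inner_le_norm _ _
  -- Lions' projection lemma
  obtain ⟨U, hU⟩ := lions_projection K j ℓ nΦ one_pos zero_le_one (norm_nonneg _)
    (fun ψ => norm_nonneg _) hcoer hemb hℓb
  -- a measurable representative and the corrector
  set Ut : ℝ × EuclideanSpace ℝ (Fin 3) → ℝ := (Lp.memLp U).1.mk U with hUt
  have hUtm : Measurable Ut := (Lp.memLp U).1.stronglyMeasurable_mk.measurable
  have hUUt : (U : ℝ × EuclideanSpace ℝ (Fin 3) → ℝ) =ᵐ[μ] Ut := (Lp.memLp U).1.ae_eq_mk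
  have hUt2 : MemLp Ut 2 μ := (Lp.memLp U).ae_eq hUUt
  have hem : Measurable fun p : ℝ × EuclideanSpace ℝ (Fin 3) => Real.exp (-p.1) * Ut p :=
    (Real.measurable_exp.comp measurable_fst.neg).mul hUtm
  set w : ℝ × EuclideanSpace ℝ (Fin 3) → ℝ := S.indicator fun p => Real.exp (-p.1) * Ut p with hw
  have hwS : MemLp (fun p : ℝ × EuclideanSpace ℝ (Fin 3) => Real.exp (-p.1) * Ut p) 2 μ := by
    refine hUt2.of_le_mul (c := Real.exp (-ta)) hem.aestronglyMeasurable ?_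
    rw [hμ, ae_restrict_iff' hSm]
    refine Eventually.of_forall fun p hp => ?_
    rw [norm_mul, Real.norm_eq_abs, abs_of_pos (Real.exp_pos _)]
    exact mul_le_mul_of_nonneg_right (Real.exp_le_exp.2 (by linarith [hp.1.1])) (norm_nonneg _)
  have hw2 : MemLp w 2 volume := by
    rw [hw, memLp_indicator_iff_restrict hSm]; exact hwS
  refine ⟨w, hem.indicator hSm, hw2, fun p hp => ?_, ?_, fun φ hφ hφc hφT => ?_⟩
  · rw [hw, indicator_of_notMem (fun h : p ∈ S => hp h.1)]
  · have hΓ : LocallyIntegrableOn (fun p : ℝ × EuclideanSpace ℝ (Fin 3) => F p.1 p.2)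
        (Ioo ta T ×ˢ univ) volume :=
      ContinuousOn.locallyIntegrableOn
        (hFc.mono (Set.prod_mono Ioo_subset_Iio_self Subset.rfl))
        (measurableSet_Ioo.prod MeasurableSet.univ)
    exact hΓ.add ((hw2.locallyIntegrable one_le_two).locallyIntegrableOn _)
  · -- the very weak identity
    have hφT' : tsupport φ ⊆ Iio T ×ˢ univ :=
      hφT.trans (Set.prod_mono Ioo_subset_Iio_self Subset.rfl)
    have hφ0 : ∀ p : ℝ × EuclideanSpace ℝ (Fin 3), p.1 ≤ ta → φ p = 0 := fun p hp =>
      image_eq_zero_of_notMem_tsupport fun h => (not_lt.2 hp) (hφT h).1.1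
    have hφ1 := weakCorrector_contDiff_one_of_infty hφ
    obtain ⟨Sφ, hSφ⟩ : ∃ Sφ : ℝ × EuclideanSpace ℝ (Fin 3) → ℝ, Sφ = fun p => deriv (fun s => φ
        (s, p.2)) p.1 +
        fderiv ℝ (fun y => φ (p.1, y)) p.2 (b p.1 p.2) - ν * (Δ (fun y => φ (p.1, y))) p.2 :=
      ⟨_, rfl⟩
    obtain ⟨Gs, hGs⟩ : ∃ Gs : ℝ × EuclideanSpace ℝ (Fin 3) → ℝ,
        Gs = fun p => fderiv ℝ (F p.1) p.2 (b p.1 p.2) := ⟨_, rfl⟩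
    have cSφ : Continuous Sφ := by
      rw [hSφ]
      exact ((weakCorrector_continuous_deriv_slice hφ1).add
        (weakCorrector_continuous_fderiv_slice hφ1 hbc)).sub
        (continuous_const.mul (weakCorrector_continuous_laplacian_slice hφ))
    have zSφ : ∀ p, p ∉ tsupport φ → Sφ p = 0 := fun p hp => by
      simp only [hSφ]
      rw [weakCorrector_deriv_slice_eq_zero hφ1 hp, weakCorrector_fderiv_slice_eq_zero hφ1 hp,
        weakCorrector_laplacian_slice_eq_zero (weakCorrector_contDiff_two_of_infty hφ) hp]
      ring
    -- (B) the kernel part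
    have hBpart : ∫ p : ℝ × EuclideanSpace ℝ (Fin 3), F p.1 p.2 * Sφ p =
        -∫ p, Gs p * φ p := by
      rw [hSφ, hGs]; exact caloric_ibp hν hf hfc hF hb1 hdiv hφ hφc hφT'
    -- (A) the corrector part, through the shifted test function `ψ = e^{-t} φ`
    set ψ : ℝ × EuclideanSpace ℝ (Fin 3) → ℝ := fun p => Real.exp (-p.1) * φ p with hψ
    have hψΦ : ψ ∈ Φ := ⟨weakCorrector_shift_contDiff hφ, weakCorrector_shift_hasCompactSupport hφc,
      fun p hp => by simp only [hψ, hφ0 p hp, mul_zero]⟩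
    have hKψ : ∀ p, Kf ψ p = Real.exp (-p.1) * Sφ p := fun p => by
      simp only [hKf, hSφ, hψ]
      exact weakCorrector_shift_op hφ ν b p
    have key := hU ⟨ψ, hψΦ⟩
    have hlhs : ⟪U, K ⟨ψ, hψΦ⟩⟫_ℝ = ∫ p, Ut p * Kf ψ p ∂μ := by
      have h1 : ⟪U, K ⟨ψ, hψΦ⟩⟫_ℝ = ⟪hUt2.toLp Ut, (hmemK ⟨ψ, hψΦ⟩).toLp (Kf ψ)⟫_ℝ := by
        congr 1
        exact (Lp.toLp_coeFn U (Lp.memLp U)).symm.trans (MemLp.toLp_congr _ _ hUUt)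
      rw [h1, weakCorrector_inner_toLp_toLp]
    have hrhs : ℓ ⟨ψ, hψΦ⟩ = ∫ p, Gs p * φ p ∂μ := by
      change ∫ p, gF p * ψ p ∂μ = _
      refine integral_congr_ae (Eventually.of_forall fun p => ?_)
      simp only [hgF, hψ, hGs]
      rw [Real.exp_neg]
      field_simp
    rw [hlhs, hrhs] at key
    have hwpart : ∫ p, w p * Sφ p = ∫ p, Ut p * Kf ψ p ∂μ := by
      rw [hμ, ← integral_indicator hSm]
      refine integral_congr_ae (Eventually.of_forall fun p => ?_)
      simp only [hw]
      by_cases hp : p ∈ S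
      · rw [indicator_of_mem hp, indicator_of_mem hp, hKψ]; ring
      · rw [indicator_of_notMem hp, indicator_of_notMem hp, zero_mul]
    have hFS : ∫ p, Gs p * φ p = ∫ p, Gs p * φ p ∂μ := by
      rw [hμ, ← integral_indicator hSm]
      refine integral_congr_ae (Eventually.of_forall fun p => ?_)
      by_cases hp : p ∈ S
      · rw [indicator_of_mem hp]
      · rw [indicator_of_notMem hp]
        show Gs p * φ p = 0
        have hp' : p.1 ∉ Ioo ta Ta := fun h => hp ⟨h, mem_univ _⟩
        rcases le_or_gt p.1 ta with h1 | h1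
        · rw [hφ0 p h1, mul_zero]
        · have h2 : Ta ≤ p.1 := not_lt.1 fun h => hp' ⟨h1, h⟩
          simp only [hGs, hb0 p.1 (hT₁.le.trans h2) p.2, map_zero, zero_mul]
    -- integrability of the two products
    have iΓ : Integrable (fun p : ℝ × EuclideanSpace ℝ (Fin 3) => F p.1 p.2 * Sφ p) :=
      weakCorrector_integrable_mul_of_tsupport (isOpen_Iio.prod isOpen_univ) hFc cSφ hφc hφT' zSφ
    have hSφ2 : MemLp Sφ 2 volume :=
      cSφ.memLp_of_hasCompactSupport (weakCorrector_hasCompactSupport_of_eq_zero hφc zSφ)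
    have iw : Integrable (fun p : ℝ × EuclideanSpace ℝ (Fin 3) => w p * Sφ p) :=
        hw2.integrable_mul hSφ2
    have e0 : ∫ p, (F p.1 p.2 + w p) *
        (deriv (fun s => φ (s, p.2)) p.1 + fderiv ℝ (fun y => φ (p.1, y)) p.2 (b p.1 p.2) -
          ν * (Δ (fun y => φ (p.1, y))) p.2) =
        ∫ p, (F p.1 p.2 + w p) * Sφ p := by simp only [hSφ]
    rw [e0]
    calc ∫ p, (F p.1 p.2 + w p) * Sφ p
        = (∫ p, F p.1 p.2 * Sφ p) + ∫ p, w p * Sφ p := by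
          rw [← integral_add iΓ iw]
          exact integral_congr_ae (Eventually.of_forall fun p => add_mul _ _ _)
      _ = 0 := by rw [hBpart, hwpart, key, hFS]; ring

/-! ### Registered sub-goal -/

/-- **Registered sub-goal `stub_blockSolver_correctorCore`** (closed form of `corrector_core`,
sub-goal of STUB `stub_blockSolver`): the very weak `L²` corrector of the caloric extension for a
globally smooth, bounded drift with divergence-free slices vanishing for `t ≥ T₁`. -/
theorem stub_blockSolver_correctorCore :
    ∀ (ν T ta T₁ Ta B : ℝ) (f : (EuclideanSpace ℝ (Fin 3)) → ℝ) (b : ℝ → (EuclideanSpace ℝ (Fin 3)) → (EuclideanSpace ℝ (Fin 3))), 0 < ν → ContDiff ℝ 2 f → HasCompactSupport f → ta < T₁ → T₁ < Ta → Ta < T → ContDiff ℝ (⊤ : ℕ∞) (uncurry b) → (∀ t, VectorCalculus.IsDivFree (b t)) → (∀ t x, ‖b t x‖ ≤ B) → (∀ t, T₁ ≤ t → ∀ x, b t x = 0) → ∃ w : ℝ × (EuclideanSpace ℝ (Fin 3)) → ℝ, Measurable w ∧ MemLp w 2 volume ∧ (∀ p, p.1 ∉ Ioo ta Ta → w p =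 0) ∧ LocallyIntegrableOn (fun p => Literature.Analysis.UnboundedOperators.heatExtension f (ν * (T - p.1)) p.2 + w p) (Ioo ta T ×ˢ univ) volume ∧ ∀ φ : ℝ × (EuclideanSpace ℝ (Fin 3)) → ℝ, ContDiff ℝ (⊤ : ℕ∞) φ → HasCompactSupport φ → tsupport φ ⊆ Ioo ta T ×ˢ univ → ∫ p, (Literature.Analysis.UnboundedOperators.heatExtension f (ν * (T - p.1)) p.2 + w p) * (deriv (fun s => φ (s, p.2)) p.1 + fderiv ℝ (fun y => φ (p.1, y)) p.2 (b p.1 p.2) - ν * Laplacian.laplacian (fun y => φ (p.1, y)) p.2) = 0 :=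
  fun _ _ _ _ _ _ _ _ hν hf hfc hta hT₁ hTa hb hdiv hB hb0 =>
    corrector_core hν hf hfc rfl hta hT₁ hTa hb hdiv hB hb0

end Summit.NavierStokesRegularity.NavierStokesRegularity.Theorems.AdaptedFrequencyConverges.CloudFrameEffectiveTsai

end
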